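import Summits.QuantumFields.YangMills.Theorems.LuscherReductionTwistedTraceScalingGnomonicKinetic
import Summits.QuantumFields.YangMills.Theorems.LuscherReductionTwistedTraceScalingMagneticLattice
import HarnessLib

/-!
# The magnetic term in the lattice GNOMONIC chart: `|S(P(w)) − ‖d w‖²| ≤ 2000·|P|·ρ³` for `max_e |w_e| ≤ ρ ≤ 1/2`
# (lane B of S-BASE, crux `TwistedTraceScaling` stmt-QuantumFields-20203; the Laplace step of both COARSE lanes, in the chart of `…LatticeGnChart`)

`…MagneticLattice.abs_wilsonAction_sub_stiff_le` controls `S(U) − ‖d(linkVec U)‖²` by `644|P|r³` on the Frobenius `r`-ball; on the vacuum pattern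
of the gnomonic chart, `U_e = P(1,w_e)` has `‖U_e − 1‖_F² ≤ 2|w_e|²` and tangent coordinate `v_e = w_e/√(1+|w_e|²)`, `|v_e − w_e| ≤ |w_e|³/2`;
hence `‖d v‖²` and `‖d w‖²` differ by `≤ 16|P|ρ⁴·(…)` and the Wilson action is the curl form OF THE CHART COORDINATES up to `O(|P|ρ³)`:
`abs_wilsonAction_gnomonic_sub_curl_le`.  With `…GnomonicKinetic(Lattice)` (kinetic Gaussian) and `…LatticeGnChart`/`…VacuumPattern` (measure)
the true kernel restricted to the bulk is the harmonic model of `…StiffHessian` in the integration variables `w`, up to explicit exponent errors.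
HONEST FRAMING: algebra/bookkeeping; femto rung R2b1 (stub of a child of a CONDITIONAL route); not a gap, not Clay.
-/

set_option autoImplicit false

noncomputable section

open scoped BigOperators RealInnerProductSpace
open Literature.MathematicalPhysics.QuantumFieldTheory
open Literature.MathematicalPhysics.QuantumLattice
open Literature.MathematicalPhysics.QuantumFieldTheory.Balaban1983to89.T4CubeChartGnomonic (gnoPoint)

namespace Summit.QuantumFields.YangMills.Theorems.FemtoTransferGap.TwoLattice.GnChart

open Summit.QuantumFields.YangMills.Theorems.FemtoTransferGap
open Summit.QuantumFields.YangMills.Theorems.FemtoTransferGap.TwoLattice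
open Summit.QuantumFields.YangMills.Theorems.FemtoTransferGap.TwoLattice.Stiff

variable (L : ℕ) [NeZero L]

/-! ## §1 One link in the chart -/

/-- `1 − 1/√(1+x) ≤ x/2` for `x ≥ 0`. [folklore] -/
theorem one_sub_inv_sqrt_le {x : ℝ} (hx : 0 ≤ x) : 0 ≤ 1 - (Real.sqrt (1 + x))⁻¹ ∧ 1 - (Real.sqrt (1 + x))⁻¹ ≤ x / 2 := by
  have h1 : 1 ≤ Real.sqrt (1 + x) := Real.one_le_sqrt.mpr (by linarith)
  have hpos : 0 < Real.sqrt (1 + x) := by linarith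
  have hsq : Real.sqrt (1 + x) ^ 2 = 1 + x := Real.sq_sqrt (by linarith)
  constructor
  · rw [sub_nonneg]; exact inv_le_one_of_one_le₀ h1
  · -- `1 − 1/q ≤ q − 1 ≤ x/2` with `q = √(1+x)`: `(q−1) ≤ x/2 ⟸ q ≤ 1 + x/2 ⟸ q² ≤ (1+x/2)²`
    have h2 : Real.sqrt (1 + x) ≤ 1 + x / 2 := by nlinarith [hsq, sq_nonneg x]
    have h3 : 1 - (Real.sqrt (1 + x))⁻¹ ≤ Real.sqrt (1 + x) - 1 := by
      rw [sub_le_sub_iff]; nlinarith [inv_pos.2 hpos, mul_inv_cancel₀ hpos.ne', sq_nonneg (Real.sqrt (1 + x) - 1)]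
    linarith

/-- On the vacuum pattern: `s_e = (1+|w_e|²)^{-1/2}`, `v_e = s_e w_e`, `‖P(w_e) − 1‖_F² = 4(1 − s_e) ≤ 2|w_e|²`, and `(v_e − w_e)_a = −(1−s_e) w_e a`.
[folklore] -/
theorem link_chart_bounds (y : Fin 3 → ℝ) :
    frobNorm ((gnoPoint y : Matrix (Fin 2) (Fin 2) ℂ) - 1) ^ 2 ≤ 2 * ∑ a, y a ^ 2 ∧
      0 ≤ 1 - scalarPart (gnoPoint y) ∧ 1 - scalarPart (gnoPoint y) ≤ (∑ a, y a ^ 2) / 2 ∧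
      ∀ a, vecPart (gnoPoint y) a - y a = -((1 - scalarPart (gnoPoint y)) * y a) := by
  obtain ⟨hs, hsA, hv⟩ := gnoPoint_chart y
  have hx : 0 ≤ ∑ a, y a ^ 2 := Finset.sum_nonneg fun a _ => sq_nonneg _
  have hseq : scalarPart (gnoPoint y) = (Real.sqrt (1 + ∑ a, y a ^ 2))⁻¹ := by
    rw [scalarPart_gnoPoint, ← Real.sqrt_sq (norm_nonneg (Literature.MathematicalPhysics.QuantumLattice.gnomonicQuat y)), sq_norm_gnomonicQuat]
  have h1 := one_sub_inv_sqrt_le hx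
  rw [← hseq] at h1
  refine ⟨?_, h1.1, h1.2, fun a => by rw [hv a]; ring⟩
  rw [frobNorm_sub_one_sq_eq_scalarPart]; linarith [h1.2]

/-! ## §2 The chart coordinates as a `LinkSpace` vector -/

variable {L} in
/-- The chart coordinates `w : Edge → ℝ³` as an element of `LinkSpace L`. [folklore] -/
def chartVec (w : Edge 3 L → Fin 3 → ℝ) : LinkSpace L := WithLp.toLp 2 fun ea : Edge 3 L × Fin 3 => w ea.1 ea.2

omit [NeZero L] in
/-- Components. [folklore] -/
@[simp] theorem chartVec_apply (w : Edge 3 L → Fin 3 → ℝ) (e : Edge 3 L) (a : Fin 3) : chartVec w (e, a) = w e a := rfl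

/-- ★ **The Wilson action in the gnomonic chart is the curl form of the chart coordinates up to `O(|P|ρ³)`**: if `Σ_a w_e a² ≤ ρ²` on every
link with `0 ≤ ρ ≤ 1/2`, then `|S(P(w)) − ‖latCurl L (chartVec w)‖²| ≤ 2000·|P|·ρ³`. [cite: Luscher1983, §3] [cite: MontvayMunster1994, §3.2.3] -/
theorem abs_wilsonAction_gnomonic_sub_curl_le {ρ : ℝ} (hρ0 : 0 ≤ ρ) (hρ : ρ ≤ 1 / 2) (w : Edge 3 L → Fin 3 → ℝ)
    (hw : ∀ e, ∑ a, w e a ^ 2 ≤ ρ ^ 2) :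
    |wilsonAction su2Rep (latPatternChart L (fun _ => false) w) - ‖latCurl L (chartVec w)‖ ^ 2| ≤
      2000 * Fintype.card (Plaquette 3 L) * ρ ^ 3 := by
  set U := latPatternChart L (fun _ => false) w with hU
  -- Frobenius radius `r = √2 ρ ≤ 1`
  have hr : ∀ e, frobNorm ((U e : Matrix (Fin 2) (Fin 2) ℂ) - 1) ≤ Real.sqrt 2 * ρ := fun e => by
    rw [hU, latPatternChart_false]
    have h1 := (link_chart_bounds (w e)).1
    have h2 : frobNorm ((gnoPoint (w e) : Matrix (Fin 2) (Fin 2) ℂ) - 1) ^ 2 ≤ (Real.sqrt 2 * ρ) ^ 2 := by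
      rw [mul_pow, Real.sq_sqrt (by norm_num)]; linarith [hw e]
    exact (pow_le_pow_iff_left₀ (frobNorm_nonneg _) (by positivity) two_ne_zero).mp h2
  have hr1 : Real.sqrt 2 * ρ ≤ 1 := by nlinarith [Real.sq_sqrt (show (0:ℝ) ≤ 2 by norm_num), Real.sqrt_nonneg 2]
  have hA := abs_wilsonAction_sub_stiff_le U hr1 hr
  -- compare `‖d(linkVec U)‖²` with `‖d(chartVec w)‖²`
  have hB : |‖latCurl L (linkVec L U)‖ ^ 2 - ‖latCurl L (chartVec w)‖ ^ 2| ≤ 48 * Fintype.card (Plaquette 3 L) * ρ ^ 4 := by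
    rw [norm_latCurl_sq, norm_latCurl_sq, ← Finset.sum_sub_distrib]
    refine (Finset.abs_sum_le_sum_abs _ _).trans ?_
    have hq : ∀ q : Plaquette 3 L × Fin 3, |latCurl L (linkVec L U) q ^ 2 - latCurl L (chartVec w) q ^ 2| ≤ 16 * ρ ^ 4 := by
      rintro ⟨⟨x, ij⟩, a⟩
      rw [latCurl_apply, latCurl_apply]
      simp only [linkVec_apply, chartVec_apply]
      -- each of the four links: `|v_e a − w_e a| ≤ (ρ²/2)·|w_e a|`, `|v_e a| ≤ |w_e a| ≤ ρ`
      have hlink : ∀ e : Edge 3 L, |vecPart (U e) a - w e a| ≤ ρ ^ 2 / 2 * ρ ∧ |w e a| ≤ ρ ∧ |vecPart (U e) a| ≤ ρ := by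
        intro e
        rw [hU, latPatternChart_false]
        obtain ⟨-, h0, h1, h2⟩ := link_chart_bounds (w e)
        have hspos := scalarPart_gnoPoint_pos (w e)
        have hwa : |w e a| ≤ ρ := by
          have : w e a ^ 2 ≤ ρ ^ 2 := le_trans (Finset.single_le_sum (fun b _ => sq_nonneg (w e b)) (Finset.mem_univ a)) (hw e)
          exact abs_le_of_sq_le_sq' this hρ0 |> fun h => abs_le.2 h
        have hwe := hw e
        have h3 : 1 - scalarPart (gnoPoint (w e)) ≤ ρ ^ 2 / 2 := by linarith
        refine ⟨?_, hwa, ?_⟩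
        · rw [h2 a, abs_neg, abs_mul, abs_of_nonneg h0]
          exact mul_le_mul h3 hwa (abs_nonneg _) (by positivity)
        · rw [show vecPart (gnoPoint (w e)) a = w e a + (vecPart (gnoPoint (w e)) a - w e a) by ring, h2 a]
          calc |w e a + -((1 - scalarPart (gnoPoint (w e))) * w e a)| = |scalarPart (gnoPoint (w e)) * w e a| := by ring_nf
            _ = |scalarPart (gnoPoint (w e))| * |w e a| := abs_mul _ _
            _ ≤ 1 * ρ := mul_le_mul (by rw [abs_of_nonneg hspos.le]; linarith) hwa (abs_nonneg _) zero_le_one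
            _ = ρ := one_mul _
      obtain ⟨d1, w1, v1⟩ := hlink (x, ij.1.1)
      obtain ⟨d2, w2, v2⟩ := hlink (x.shift ij.1.1, ij.1.2)
      obtain ⟨d3, w3, v3⟩ := hlink (x.shift ij.1.2, ij.1.1)
      obtain ⟨d4, w4, v4⟩ := hlink (x, ij.1.2)
      rw [sq_sub_sq, abs_mul]
      have hsum : |vecPart (U (x, ij.1.1)) a + vecPart (U (x.shift ij.1.1, ij.1.2)) a - vecPart (U (x.shift ij.1.2, ij.1.1)) a -
            vecPart (U (x, ij.1.2)) a + (w (x, ij.1.1) a + w (x.shift ij.1.1, ij.1.2) a - w (x.shift ij.1.2, ij.1.1) a - w (x, ij.1.2) a)|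
          ≤ 8 * ρ := by
        have := abs_le.1 v1; have := abs_le.1 v2; have := abs_le.1 v3; have := abs_le.1 v4
        have := abs_le.1 w1; have := abs_le.1 w2; have := abs_le.1 w3; have := abs_le.1 w4
        rw [abs_le]; constructor <;> linarith
      have hdiff : |vecPart (U (x, ij.1.1)) a + vecPart (U (x.shift ij.1.1, ij.1.2)) a - vecPart (U (x.shift ij.1.2, ij.1.1)) a -
            vecPart (U (x, ij.1.2)) a - (w (x, ij.1.1) a + w (x.shift ij.1.1, ij.1.2) a - w (x.shift ij.1.2, ij.1.1) a - w (x, ij.1.2) a)|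
          ≤ 2 * ρ ^ 3 := by
        have := abs_le.1 d1; have := abs_le.1 d2; have := abs_le.1 d3; have := abs_le.1 d4
        rw [abs_le]; constructor <;> nlinarith
      calc _ ≤ 8 * ρ * (2 * ρ ^ 3) := mul_le_mul hsum hdiff (abs_nonneg _) (by positivity)
        _ = 16 * ρ ^ 4 := by ring
    refine (Finset.sum_le_sum fun q _ => hq q).trans ?_
    rw [Finset.sum_const, Finset.card_univ, nsmul_eq_mul, Fintype.card_prod, Fintype.card_fin]
    push_cast
    nlinarith [pow_nonneg hρ0 4]
  -- assemble: `644|P|(√2ρ)³ + 48|P|ρ⁴ ≤ 2000|P|ρ³`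
  have hP0 : (0 : ℝ) ≤ Fintype.card (Plaquette 3 L) := by positivity
  have hs2 : Real.sqrt 2 ^ 3 ≤ 3 := by
    have h := Real.sq_sqrt (show (0 : ℝ) ≤ 2 by norm_num)
    have h1 : Real.sqrt 2 ≤ 3 / 2 := by nlinarith [Real.sqrt_nonneg 2]
    nlinarith [Real.sqrt_nonneg 2]
  have h1 : 644 * Fintype.card (Plaquette 3 L) * (Real.sqrt 2 * ρ) ^ 3 ≤ 1932 * Fintype.card (Plaquette 3 L) * ρ ^ 3 := by
    rw [mul_pow]; nlinarith [mul_nonneg hP0 (pow_nonneg hρ0 3), hs2]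
  have h2 : 48 * Fintype.card (Plaquette 3 L) * ρ ^ 4 ≤ 24 * Fintype.card (Plaquette 3 L) * ρ ^ 3 := by
    have : ρ ^ 4 ≤ ρ ^ 3 / 2 := by nlinarith [pow_nonneg hρ0 3]
    nlinarith [mul_nonneg hP0 (pow_nonneg hρ0 3)]
  calc |wilsonAction su2Rep U - ‖latCurl L (chartVec w)‖ ^ 2|
      ≤ |wilsonAction su2Rep U - ‖latCurl L (linkVec L U)‖ ^ 2| + |‖latCurl L (linkVec L U)‖ ^ 2 - ‖latCurl L (chartVec w)‖ ^ 2| :=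
        abs_sub_le _ _ _
    _ ≤ 644 * Fintype.card (Plaquette 3 L) * (Real.sqrt 2 * ρ) ^ 3 + 48 * Fintype.card (Plaquette 3 L) * ρ ^ 4 := add_le_add hA hB
    _ ≤ 2000 * Fintype.card (Plaquette 3 L) * ρ ^ 3 := by nlinarith [h1, h2, mul_nonneg hP0 (pow_nonneg hρ0 3)]

end Summit.QuantumFields.YangMills.Theorems.FemtoTransferGap.TwoLattice.GnChart

end
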